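import Literature.Analysis.PDE.AffineWordBounds
import Literature.Analysis.PDE.SlabEnergyBounds
import HarnessLib

/-!
# Slab fields that are eventually constant in space: uniform derivative bounds and a modulus of
# continuity (topic `Analysis/PDE`)

Layer (I') of the programme to prove short-time existence for quasilinear strictly parabolic
systems on a closed manifold (hypothesis `hQL` of
`Literature.Geometry.Riemannian.ricciFlow_shortTime_existence_of_quasilinear`). The flat fine
parametrix is run with coefficient fields on `[0, T] × E'` that are CONSTANT outside a ball (chart
coefficients cut off to the flat operator); this file supplies the uniform quantities its
contraction needs:

* `iterDirDeriv_congr_of_eventuallyEq`, `iterDirDeriv_eq_zero_of_eventually_const` — words of a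
  locally constant function vanish;
* `exists_forall_iterDirDeriv_slab_le` — uniform (in `s ∈ [0, T]` and `y`) bounds of all frame
  words of length `≤ K` of a slab-smooth, eventually constant field, hence
  `exists_forall_iteratedFDeriv_slab_le` — of its spatial iterated derivatives;
* `exists_modulus_of_eventually_const` — a uniform modulus of continuity of a continuous function
  that is constant outside a ball.

Everything is proved; no named fact and no `sorry` is introduced.

## References

* L. Hörmander, *The Analysis of Linear Partial Differential Operators I*, Springer 1983,
  §1.1. [folklore]
-/

noncomputable section

open Set Function Filter Topology Metric
open scoped ContDiff Topology

namespace Literature.Analysis.PDE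

open Literature.Analysis.FunctionSpaces Literature.Analysis.FluidPDE

variable {E' : Type*} [NormedAddCommGroup E'] [InnerProductSpace ℝ E'] [FiniteDimensional ℝ E']
variable {V : Type*} [NormedAddCommGroup V] [NormedSpace ℝ V]

/-! ### Words of locally constant functions -/

omit [InnerProductSpace ℝ E'] [FiniteDimensional ℝ E'] in
/-- Word derivatives only depend on the germ. [folklore] -/
theorem iterDirDeriv_congr_of_eventuallyEq [NormedSpace ℝ E'] {f g : E' → V} {y : E'} :
    ∀ β : List E', f =ᶠ[𝓝 y] g → iterDirDeriv β f =ᶠ[𝓝 y] iterDirDeriv β g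
  | [], h => h
  | v :: β, h => by
    have ih : ∀ᶠ z in 𝓝 y, iterDirDeriv β f =ᶠ[𝓝 z] iterDirDeriv β g :=
      (eventually_eventuallyEq_nhds.2 h).mono fun z hz ↦ iterDirDeriv_congr_of_eventuallyEq β hz
    rw [iterDirDeriv_cons, iterDirDeriv_cons]
    filter_upwards [ih] with z hz
    rw [hz.fderiv_eq]

omit [InnerProductSpace ℝ E'] [FiniteDimensional ℝ E'] in
/-- **Nonempty words of a locally constant function vanish.** [folklore] -/
theorem iterDirDeriv_eq_zero_of_eventually_const [NormedSpace ℝ E'] {f : E' → V} {y : E'} {c : V}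
    (h : f =ᶠ[𝓝 y] fun _ ↦ c) {β : List E'} (hβ : β ≠ []) : iterDirDeriv β f y = 0 := by
  have h1 := (iterDirDeriv_congr_of_eventuallyEq β h).self_of_nhds
  rw [h1, iterDirDeriv_const_of_ne_nil c hβ]
  rfl

/-! ### Uniform word bounds of eventually constant slab fields -/

omit [FiniteDimensional ℝ E'] in
/-- Frame words of a slab-smooth field are jointly smooth on the slab (any normed codomain).
[folklore] -/
private theorem contDiffOn_uncurry_iterDirDeriv_slab {T : ℝ} (hT : 0 < T) {F : ℝ → E' → V}
    (hF : IsSmoothSpaceTimeOn (Icc 0 T) F) :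
    ∀ β : List E', ContDiffOn ℝ ∞ (uncurry fun t y ↦ iterDirDeriv β (F t) y) (Icc 0 T ×ˢ univ)
  | [] => hF
  | v :: β => by
    have ih : IsSmoothSpaceTimeOn (Icc 0 T) fun t y ↦ iterDirDeriv β (F t) y := contDiffOn_uncurry_iterDirDeriv_slab hT hF β
    exact (ih.fderiv_slice (uniqueDiffOn_Icc hT)).clm_apply (isSmoothSpaceTimeOn_const_time contDiff_const _)

/-- **Uniform bounds of one frame word of a slab-smooth, eventually constant field.** [folklore] -/
theorem exists_forall_iterDirDeriv_slab_le_word {T : ℝ} (hT : 0 < T) {F : ℝ → E' → V}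
    (hF : IsSmoothSpaceTimeOn (Icc 0 T) F) {c : V} {Rc : ℝ} (hconst : ∀ s y, Rc ≤ ‖y‖ → F s y = c)
    (β : List E') :
    ∃ M : ℝ, 0 ≤ M ∧ ∀ s ∈ Icc 0 T, ∀ y, ‖iterDirDeriv β (F s) y‖ ≤ M := by
  -- continuity of the word on the compact `[0, T] × closedBall 0 (|Rc| + 1)`
  have hcont : ContinuousOn (fun q : ℝ × E' ↦ iterDirDeriv β (F q.1) q.2) (Icc 0 T ×ˢ univ) :=
    (contDiffOn_uncurry_iterDirDeriv_slab hT hF β).continuousOn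
  obtain ⟨C, hC⟩ := (isCompact_Icc.prod (isCompact_closedBall (0 : E') (|Rc| + 1))).exists_bound_of_continuousOn
    (hcont.mono (prod_mono Subset.rfl (subset_univ _)))
  refine ⟨max C ‖c‖, le_max_of_le_right (norm_nonneg _), fun s hs y ↦ ?_⟩
  by_cases hy : y ∈ closedBall (0 : E') (|Rc| + 1)
  · exact (hC (s, y) (mk_mem_prod hs hy)).trans (le_max_left _ _)
  · -- outside: the slice is locally constant
    have hy' : |Rc| + 1 < ‖y‖ := by simpa [dist_zero_right] using hy
    have hev : F s =ᶠ[𝓝 y] fun _ ↦ c := by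
      have hopen : IsOpen {z : E' | |Rc| < ‖z‖} := isOpen_lt continuous_const continuous_norm
      filter_upwards [hopen.mem_nhds (show |Rc| < ‖y‖ by linarith)] with z hz
      exact hconst s z ((le_abs_self Rc).trans hz.le)
    by_cases hβ : β = []
    · subst hβ
      rw [iterDirDeriv_nil, hev.self_of_nhds]
      exact le_max_right _ _
    · rw [iterDirDeriv_eq_zero_of_eventually_const hev hβ, norm_zero]
      exact le_max_of_le_right (norm_nonneg _)

/-- **Uniform bounds of all frame words of length `≤ K`** of a slab-smooth, eventually constant
field. [folklore] -/
theorem exists_forall_iterDirDeriv_slab_le {T : ℝ} (hT : 0 < T) {F : ℝ → E' → V}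
    (hF : IsSmoothSpaceTimeOn (Icc 0 T) F) {c : V} {Rc : ℝ} (hconst : ∀ s y, Rc ≤ ‖y‖ → F s y = c) (K : ℕ) :
    ∃ M : ℝ, 0 ≤ M ∧ ∀ s ∈ Icc 0 T, ∀ m ≤ K, ∀ v : Fin m → Fin (Module.finrank ℝ E'), ∀ y,
      ‖iterDirDeriv (List.ofFn fun k ↦ stdOrthonormalBasis ℝ E' (v k)) (F s) y‖ ≤ M := by
  classical
  -- finitely many words: index by `m ≤ K` and `v : Fin m → Fin n`
  have hw : ∀ m (v : Fin m → Fin (Module.finrank ℝ E')), ∃ M : ℝ, 0 ≤ M ∧ ∀ s ∈ Icc 0 T, ∀ y,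
      ‖iterDirDeriv (List.ofFn fun k ↦ stdOrthonormalBasis ℝ E' (v k)) (F s) y‖ ≤ M := fun m v ↦
    exists_forall_iterDirDeriv_slab_le_word hT hF hconst _
  choose M hM0 hM using hw
  refine ⟨∑ m ∈ Finset.range (K + 1), ∑ v : Fin m → Fin (Module.finrank ℝ E'), M m v,
    Finset.sum_nonneg fun m _ ↦ Finset.sum_nonneg fun v _ ↦ hM0 m v, fun s hs m hm v y ↦ ?_⟩
  refine (hM m v s hs y).trans ?_
  have h1 : M m v ≤ ∑ v' : Fin m → Fin (Module.finrank ℝ E'), M m v' :=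
    Finset.single_le_sum (f := fun v' ↦ M m v') (fun _ _ ↦ hM0 m _) (Finset.mem_univ v)
  exact h1.trans (Finset.single_le_sum (f := fun m ↦ ∑ v' : Fin m → Fin (Module.finrank ℝ E'), M m v')
    (fun _ _ ↦ Finset.sum_nonneg fun _ _ ↦ hM0 _ _) (Finset.mem_range.2 (Nat.lt_succ_of_le hm)))

/-- **Uniform bounds of the spatial iterated derivatives up to order `K`** of a slab-smooth,
eventually constant field (`s ∈ [0, T]`, all `y`). [folklore] -/
theorem exists_forall_iteratedFDeriv_slab_le {T : ℝ} (hT : 0 < T) {F : ℝ → E' → V}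
    (hF : IsSmoothSpaceTimeOn (Icc 0 T) F) {c : V} {Rc : ℝ} (hconst : ∀ s y, Rc ≤ ‖y‖ → F s y = c) (K : ℕ) :
    ∃ M : ℝ, 0 ≤ M ∧ ∀ s ∈ Icc 0 T, ∀ m ≤ K, ∀ y, ‖iteratedFDeriv ℝ m (F s) y‖ ≤ M := by
  obtain ⟨Mw, hMw0, hMw⟩ := exists_forall_iterDirDeriv_slab_le hT hF hconst K
  refine ⟨(Module.finrank ℝ E' : ℝ) ^ K * Mw + Mw, by positivity, fun s hs m hm y ↦ ?_⟩
  have h := norm_iteratedFDeriv_le_of_frame_words (hF.contDiff_slice hs) m y hMw0 fun v ↦ hMw s hs m hm v y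
  refine h.trans ?_
  have hpow : (Module.finrank ℝ E' : ℝ) ^ m ≤ (Module.finrank ℝ E' : ℝ) ^ K + 1 := by
    rcases Nat.eq_zero_or_pos (Module.finrank ℝ E') with h0 | hpos
    · rw [h0, Nat.cast_zero]
      rcases Nat.eq_zero_or_pos m with rfl | hm0
      · rw [pow_zero]; linarith [pow_nonneg (le_refl (0 : ℝ)) K]
      · rw [zero_pow hm0.ne']; positivity
    · exact (pow_le_pow_right₀ (by exact_mod_cast hpos) hm).trans (le_add_of_nonneg_right zero_le_one)
  calc (Module.finrank ℝ E' : ℝ) ^ m * Mw ≤ ((Module.finrank ℝ E' : ℝ) ^ K + 1) * Mw := mul_le_mul_of_nonneg_right hpow hMw0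
    _ = (Module.finrank ℝ E' : ℝ) ^ K * Mw + Mw := by ring

/-! ### A modulus of continuity -/

omit [InnerProductSpace ℝ E'] [FiniteDimensional ℝ E'] [NormedSpace ℝ V] in
/-- **A uniform modulus of continuity for a continuous function constant outside a ball.**
[folklore] -/
theorem exists_modulus_of_eventually_const [NormedSpace ℝ E'] [ProperSpace E'] {f : E' → V} (hf : Continuous f)
    {c : V} {Rc : ℝ} (hconst : ∀ y, Rc ≤ ‖y‖ → f y = c) {ε : ℝ} (hε : 0 < ε) :
    ∃ δ : ℝ, 0 < δ ∧ ∀ y y', dist y y' ≤ δ → ‖f y - f y'‖ ≤ ε := by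
  -- `f - c` has compact support, hence `f` is uniformly continuous
  have hsupp : HasCompactSupport fun y ↦ f y - c := by
    refine HasCompactSupport.intro (isCompact_closedBall (0 : E') |Rc|) fun y hy ↦ ?_
    have hy' : |Rc| < ‖y‖ := by simpa [dist_zero_right] using hy
    rw [hconst y ((le_abs_self Rc).trans hy'.le), sub_self]
  have huc : UniformContinuous fun y ↦ f y - c := hsupp.uniformContinuous_of_continuous (hf.sub continuous_const)
  obtain ⟨δ, hδ, h⟩ := Metric.uniformContinuous_iff.1 huc ε hε
  refine ⟨δ / 2, by linarith, fun y y' hyy' ↦ ?_⟩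
  have h' := h (a := y) (b := y') (by linarith)
  rw [dist_eq_norm] at h'
  have : f y - f y' = (f y - c) - (f y' - c) := by abel
  rw [this]
  exact h'.le

end Literature.Analysis.PDE

end
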